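import Summits.CriticalPhenomena.PercolationContinuityZ3.Theorems.FK.PressureDifferentiabilitySet
import Summits.CriticalPhenomena.PercolationContinuityZ3.Theorems.FK.JointContinuity
import Literature.Probability.LatticeModels.MeanFieldLowerBound
import Mathlib.Analysis.Calculus.ContDiff.RCLike
import Mathlib.Data.Real.Sign
import HarnessLib

/-!
# THE GRADIENT OF THE ISING PRESSURE SURFACE IS CONTINUOUS WHEREVER IT EXISTS: `ψ ∈ C¹` on the open set
# `{β > 0} ∖ {h = 0, β ≥ β_c}`, and AT THE CRITICAL POINT `(β_c, 0)` the surface is differentiable with the gradient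
# continuous along the differentiability set — the transition is continuous (second order) at `β_c` in both variables
# (Friedli–Velenik 2017, Thm. 3.6, Thm. 3.25, Lemma 3.31, Prop. 3.29, Thm. 3.43; Aizenman–Duminil-Copin–Sidoravicius 2015)

Claimed R42 (8)(c) in the cell INBOX at 2026-08-29T04:00:50Z by fkp-10a gen 358 (NEW CLAIM #1 of the gen), addressed to coordinator fk-4 (next seated gen; gen 288 closed l.8706, (ι) in force); lineage row FO-10a-g358 (self-suggested), package g358-surface, label PS-F.
Helper file of the `fk-continuity` build cell (bschramm lane; `--supports stmt-CriticalPhenomena-4575`); builds on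
p205010 (kernel theorem, internal audit signed; external expert review pending). No definitions, no named facts, no
sorries; standard axioms. UNCONDITIONAL (nearest-neighbour Ising model on `ℤ^d`).

The candidate gradient field, defined at EVERY `(β,h)` (inline, no definition):
`∇ψ(β,h) := (Σᵢ ⟨σ_0σ_{eᵢ}⟩⁺_{β,|h|} + |h| m(β,|h|)) dβ + (β · sign h · m(β,|h|)) dh`.
It IS the Fréchet derivative of `(β,h) ↦ ψ(β,h)` at every point of the differentiability set
`D = {β > 0} ∖ {h = 0, β > β_c}` (`hasFDerivAt_pressure_grad`, from `PressureDifferentiabilitySet`), and: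

* **`continuousAt_plusCorr_abs_field_uncurry`** — for `d ≥ 2`, `0 < β ≤ β_c` and every finite `A`,
  `(b,t) ↦ ⟨σ_A⟩⁺_{b,|t|}` is JOINTLY continuous at `(β,0)` (squeeze `⟨σ_A⟩⁺_{β−ε,0} ≤ ⟨σ_A⟩⁺_{b,|t|} ≤ ⟨σ_A⟩⁺_{β+ε,|t|}`,
  GKS monotonicity, right-continuity in `h` (Lemma 3.31) and in `β`, continuity in `β` at `h = 0` up to `β_c`);
  `tendsto_magnetizationInField_abs_uncurry` — `m(b,|t|) → 0` as `(b,t) → (β,0)`, `β ≤ β_c` (also AT `β_c`: `m*(β_c) = 0`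
  and right-continuity of `m*`);
* **`continuousAt_grad_of_field_ne_zero`** (`d ≥ 1`, `h ≠ 0`; `JointContinuity`) and **`continuousAt_grad_zero_field`**
  (`d ≥ 2`, `0 < β ≤ β_c`, at `(β,0)` — INCLUDING `β = β_c`): the field `∇ψ` is continuous at every point of `D` and at
  the critical point;
* **`contDiffAt_pressure_uncurry`** — `ContDiffAt ℝ 1 (fun (β,h) => ψ(β,h)) (β,h)` at every point of the OPEN set
  `U = {β > 0, h ≠ 0} ∪ {0 < β < β_c, h = 0}` (`d ≥ 2`; `d ≥ 1` off `h = 0`: `contDiffAt_pressure_uncurry_of_field_ne_zero`),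
  **`contDiffOn_pressure_uncurry`** — `ψ ∈ C¹(U)`; `hasStrictFDerivAt_pressure_of_mem` (strict differentiability on `U`);
* **AT CRITICALITY** — `hasFDerivAt_pressure_criticalBeta` (the surface is differentiable at `(β_c,0)` with gradient
  `(Σᵢ ⟨σ_0σ_{eᵢ}⟩⁺_{β_c,0}, 0)`) and **`tendsto_fderiv_pressure_criticalBeta`**: `fderiv ψ̃ (q) → fderiv ψ̃ (β_c,0)` as
  `q → (β_c,0)` WITHIN the differentiability set `{q | DifferentiableAt ℝ ψ̃ q}` — no jump of energy or magnetisation at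
  the critical point from any direction of the `(β,h)`-plane (`ψ̃` is not `C¹` on a neighbourhood of `(β_c,0)`: it is not
  even differentiable at the points `(β,0)`, `β > β_c`).

## References

* S. Friedli, Y. Velenik, *Statistical Mechanics of Lattice Systems*, CUP (2017), Thm. 3.6, Thm. 3.25, Prop. 3.29,
  Lemma 3.31, Thm. 3.34, Thm. 3.43. [FriedliVelenik2017]
* M. Aizenman, H. Duminil-Copin, V. Sidoravicius, *Random currents and continuity of Ising model's spontaneous
  magnetization*, Comm. Math. Phys. 334 (2015), Thm. 1.2. [AizenmanDuminilCopinSidoraviciusCMP2015]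
* R. T. Rockafellar, *Convex Analysis*, Princeton (1970), Thm. 25.5. [Rockafellar1970]
-/

noncomputable section

namespace Summit.CriticalPhenomena.PercolationContinuityZ3.Theorems.FK

namespace IsingPressure

open MeasureTheory Filter Topology Finset Set
open Literature.Probability.LatticeModels
open Summit.CriticalPhenomena.PercolationContinuityZ3.Theorems.FK.IsingSusceptibility
open Summit.CriticalPhenomena.PercolationContinuityZ3.Theorems.FK.IsingEnergyDensity

variable {d : ℕ}

/-! ### The gradient field is the derivative on the differentiability set -/

/-- **`∇ψ(β,h) = (Σᵢ ⟨σ_0σ_{eᵢ}⟩⁺_{β,|h|} + |h| m(β,|h|)) dβ + (β sign(h) m(β,|h|)) dh` is the Fréchet derivative of the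
pressure surface at every `(β,h)` with `β > 0` and `h ≠ 0 ∨ β ≤ β_c(d)`** (`d ≥ 2`; the three cases of
`PressureDifferentiabilitySet` in one formula). [cite: FriedliVelenik2017, Thm. 3.43, Prop. 3.29 and Thm. 3.6] -/
theorem hasFDerivAt_pressure_grad (hd : 2 ≤ d) {β h : ℝ} (hβ : 0 < β) (hq : h ≠ 0 ∨ β ≤ criticalBeta d) :
    HasFDerivAt (fun p : ℝ × ℝ => pressure d p.1 p.2)
      ((∑ i, plusCorr d β |h| {0, Pi.single i 1} + |h| * magnetizationInField d β |h|) •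
          ContinuousLinearMap.fst ℝ ℝ ℝ +
        (β * Real.sign h * magnetizationInField d β |h|) • ContinuousLinearMap.snd ℝ ℝ ℝ) (β, h) := by
  rcases lt_trichotomy h 0 with hneg | rfl | hpos
  · have := hasFDerivAt_pressure_of_neg_field (d := d) (by omega) hβ hneg
    rw [abs_of_neg hneg, Real.sign_of_neg hneg]
    convert this using 2
    ring
  · have hβc : β ≤ criticalBeta d := hq.resolve_left (fun h => h rfl)
    have := hasFDerivAt_pressure_of_le_criticalBeta hd hβ hβc
    rw [abs_zero, Real.sign_zero]
    convert this using 2 <;> simp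
  · have := hasFDerivAt_pressure_of_pos_field (d := d) (by omega) hβ hpos
    rw [abs_of_pos hpos, Real.sign_of_pos hpos, mul_one]
    exact this

/-! ### Joint continuity of the plus state at the zero-field line, up to `β_c` -/

/-- **For `d ≥ 2`, `0 < β ≤ β_c(d)` and every finite `A`, `(b,t) ↦ ⟨σ_A⟩⁺_{b,|t|}` is jointly continuous at `(β,0)`**:
`⟨σ_A⟩⁺_{β−ε,0} ≤ ⟨σ_A⟩⁺_{b,|t|} ≤ ⟨σ_A⟩⁺_{β+ε,|t|}` for `|b − β| ≤ ε` (GKS), the right side tends to `⟨σ_A⟩⁺_{β+ε,0}` as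
`t → 0` (Lemma 3.31), and `b ↦ ⟨σ_A⟩⁺_{b,0}` is continuous at `β ≤ β_c`. [cite: FriedliVelenik2017, Lemma 3.31 and Exercise 3.17; AizenmanDuminilCopinSidoraviciusCMP2015, Thm. 1.2] -/
theorem continuousAt_plusCorr_abs_field_uncurry (hd : 2 ≤ d) {β : ℝ} (hβ : 0 < β) (hβc : β ≤ criticalBeta d)
    (A : Finset (Site d)) : ContinuousAt (fun q : ℝ × ℝ => plusCorr d q.1 |q.2| A) (β, 0) := by
  rw [Metric.continuousAt_iff]
  intro η hη
  simp only [abs_zero]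
  -- continuity in `β` at `h = 0`
  obtain ⟨ε, hε, hcont⟩ := Metric.continuousAt_iff.1 (continuousAt_plusCorr_of_le_criticalBeta hd hβ hβc A) (η / 2)
    (half_pos hη)
  set ε' := min (ε / 2) (β / 2) with hε'
  have hε'0 : 0 < ε' := lt_min (by linarith) (by linarith)
  have hε'ε : ε' < ε := lt_of_le_of_lt (min_le_left _ _) (by linarith)
  have hε'β : ε' < β := lt_of_le_of_lt (min_le_right _ _) (by linarith)
  have hup : plusCorr d (β + ε') 0 A < plusCorr d β 0 A + η / 2 := by
    have := hcont (x := β + ε') (by rw [Real.dist_eq]; simpa [abs_of_pos hε'0] using hε'ε)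
    rw [Real.dist_eq, abs_lt] at this; linarith
  have hlo : plusCorr d β 0 A - η / 2 < plusCorr d (β - ε') 0 A := by
    have := hcont (x := β - ε') (by rw [Real.dist_eq]; simpa [abs_of_pos hε'0] using hε'ε)
    rw [Real.dist_eq, abs_lt] at this; linarith
  -- right-continuity in `h` at `β + ε'`
  have hright := Metric.continuousWithinAt_iff.1
    (plusCorr_continuousWithinAt_Ici_field (d := d) (by linarith : 0 ≤ β + ε') A le_rfl) (η / 2) (half_pos hη)
  obtain ⟨τ, hτ, hτc⟩ := hright
  refine ⟨min ε' τ, lt_min hε'0 hτ, fun q hq => ?_⟩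
  have hq1 : |q.1 - β| < ε' := lt_of_le_of_lt (by rw [Prod.dist_eq, Real.dist_eq] at hq ⊢; exact le_max_left _ _)
    (lt_of_lt_of_le hq (min_le_left _ _))
  have hq2 : |q.2| < τ := by
    have : dist q.2 0 < τ := lt_of_le_of_lt (by rw [Prod.dist_eq]; exact le_max_right _ _) (lt_of_lt_of_le hq (min_le_right _ _))
    rwa [Real.dist_eq, sub_zero] at this
  rw [abs_lt] at hq1
  have hb0 : 0 ≤ β - ε' := by linarith
  -- the squeeze
  have h1 : plusCorr d (β - ε') 0 A ≤ plusCorr d q.1 |q.2| A :=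
    plusCorr_mono_params hb0 (by linarith) le_rfl (abs_nonneg _) A
  have h2 : plusCorr d q.1 |q.2| A ≤ plusCorr d (β + ε') |q.2| A :=
    plusCorr_mono_params (by linarith) (by linarith) (abs_nonneg _) le_rfl A
  have h3 : plusCorr d (β + ε') |q.2| A < plusCorr d (β + ε') 0 A + η / 2 := by
    have := hτc (x := |q.2|) (Set.mem_Ici.2 (abs_nonneg q.2)) (by rw [Real.dist_eq, sub_zero, abs_abs]; exact hq2)
    rw [Real.dist_eq, abs_lt] at this; linarith
  rw [Real.dist_eq, abs_lt]
  constructor <;> linarith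

/-- **`m(b,|t|) → 0` as `(b,t) → (β,0)` for `0 < β ≤ β_c(d)`** (`d ≥ 2`; `m(β,0) = m*(β) = 0` up to and including `β_c`).
[cite: FriedliVelenik2017, Lemma 3.31; AizenmanDuminilCopinSidoraviciusCMP2015, Thm. 1.2] -/
theorem tendsto_magnetizationInField_abs_uncurry (hd : 2 ≤ d) {β : ℝ} (hβ : 0 < β) (hβc : β ≤ criticalBeta d) :
    Tendsto (fun q : ℝ × ℝ => magnetizationInField d q.1 |q.2|) (𝓝 (β, 0)) (𝓝 0) := by
  have h := (continuousAt_plusCorr_abs_field_uncurry hd hβ hβc {0}).tendsto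
  simp only [abs_zero] at h
  rw [← spontaneousMagnetization_eq_plusCorr, spontaneousMagnetization_eq_zero_of_le_criticalBeta_two_le hd hβ.le hβc]
    at h
  simpa only [magnetizationInField_eq_plusCorr] using h

/-! ### Continuity of the gradient field -/

/-- **Continuity of `∇ψ` off the line `h = 0`** (`d ≥ 1`, `β > 0`, `h ≠ 0`), from the joint continuity of the plus
state on the open quadrant (`JointContinuity`) and spin-flip symmetry. [cite: FriedliVelenik2017, Lemma 3.31 and Thm. 3.25 (1)] -/
theorem continuousAt_grad_of_field_ne_zero (hd : 1 ≤ d) {β h : ℝ} (hβ : 0 < β) (hh : h ≠ 0) :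
    ContinuousAt (fun q : ℝ × ℝ =>
      (∑ i, plusCorr d q.1 |q.2| {0, Pi.single i 1} + |q.2| * magnetizationInField d q.1 |q.2|) •
          ContinuousLinearMap.fst ℝ ℝ ℝ +
        (q.1 * Real.sign q.2 * magnetizationInField d q.1 |q.2|) • ContinuousLinearMap.snd ℝ ℝ ℝ) (β, h) := by
  have habs : 0 < |h| := abs_pos.2 hh
  -- joint continuity at `(β, |h|)` of the plus state and of `q ↦ (q.1, |q.2|)`
  have hΦ : ContinuousAt (fun q : ℝ × ℝ => ((q.1, |q.2|) : ℝ × ℝ)) (β, h) :=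
    (continuous_fst.prodMk (continuous_abs.comp continuous_snd)).continuousAt
  -- (the composites are rewritten into `∘` form syntactically before `comp_of_eq`: unifying them up to definitional
  -- unfolding of `plusCorr` / `magnetizationInField` is prohibitively expensive)
  have hE : ContinuousAt (fun q : ℝ × ℝ =>
      ∑ i, plusCorr d q.1 |q.2| {0, Pi.single i 1} + |q.2| * magnetizationInField d q.1 |q.2|) (β, h) := by
    have e : (fun q : ℝ × ℝ => ∑ i, plusCorr d q.1 |q.2| {0, Pi.single i 1} + |q.2| * magnetizationInField d q.1 |q.2|) =
        (fun p : ℝ × ℝ => ∑ i, plusCorr d p.1 p.2 {0, Pi.single i 1} + p.2 * magnetizationInField d p.1 p.2) ∘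
          (fun q : ℝ × ℝ => ((q.1, |q.2|) : ℝ × ℝ)) := by
      funext q; simp only [Function.comp_apply]
    rw [e]
    exact ContinuousAt.comp_of_eq (continuousAt_energyField_uncurry hd hβ habs) hΦ rfl
  have hM : ContinuousAt (fun q : ℝ × ℝ => magnetizationInField d q.1 |q.2|) (β, h) := by
    have e : (fun q : ℝ × ℝ => magnetizationInField d q.1 |q.2|) =
        (fun p : ℝ × ℝ => magnetizationInField d p.1 p.2) ∘ (fun q : ℝ × ℝ => ((q.1, |q.2|) : ℝ × ℝ)) := by
      funext q; simp only [Function.comp_apply]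
    rw [e]
    exact ContinuousAt.comp_of_eq (continuousAt_magnetizationInField_uncurry hd hβ habs) hΦ rfl
  have hsign : ContinuousAt (fun q : ℝ × ℝ => Real.sign q.2) (β, h) := by
    refine (continuousAt_const (y := Real.sign h)).congr ?_
    rcases hh.lt_or_gt with hneg | hpos
    · filter_upwards [(isOpen_lt continuous_snd continuous_const).mem_nhds (show (β, h).2 < 0 from hneg)] with q hq
      rw [Real.sign_of_neg hneg, Real.sign_of_neg hq]
    · filter_upwards [(isOpen_lt continuous_const continuous_snd).mem_nhds (show 0 < (β, h).2 from hpos)] with q hq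
      rw [Real.sign_of_pos hpos, Real.sign_of_pos hq]
  exact (hE.smul continuousAt_const).add (((continuousAt_fst.mul hsign).mul hM).smul continuousAt_const)

/-- **Continuity of `∇ψ` at the zero-field points `(β,0)`, `0 < β ≤ β_c(d)` — INCLUDING THE CRITICAL POINT** (`d ≥ 2`):
the energy part tends to `Σᵢ ⟨σ_0σ_{eᵢ}⟩⁺_{β,0}`, the field part `b sign(t) m(b,|t|)` to `0`.
[cite: FriedliVelenik2017, Lemma 3.31, Prop. 3.29; AizenmanDuminilCopinSidoraviciusCMP2015, Thm. 1.2] -/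
theorem continuousAt_grad_zero_field (hd : 2 ≤ d) {β : ℝ} (hβ : 0 < β) (hβc : β ≤ criticalBeta d) :
    ContinuousAt (fun q : ℝ × ℝ =>
      (∑ i, plusCorr d q.1 |q.2| {0, Pi.single i 1} + |q.2| * magnetizationInField d q.1 |q.2|) •
          ContinuousLinearMap.fst ℝ ℝ ℝ +
        (q.1 * Real.sign q.2 * magnetizationInField d q.1 |q.2|) • ContinuousLinearMap.snd ℝ ℝ ℝ) (β, 0) := by
  have hM := tendsto_magnetizationInField_abs_uncurry hd hβ hβc
  have habs : Tendsto (fun q : ℝ × ℝ => |q.2|) (𝓝 (β, (0 : ℝ))) (𝓝 0) := by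
    simpa using (continuous_snd.tendsto ((β, 0) : ℝ × ℝ)).abs
  have hE : Tendsto (fun q : ℝ × ℝ =>
      ∑ i, plusCorr d q.1 |q.2| {0, Pi.single i 1} + |q.2| * magnetizationInField d q.1 |q.2|) (𝓝 (β, 0))
      (𝓝 (∑ i, plusCorr d β |0| {0, Pi.single i 1} + |(0 : ℝ)| * magnetizationInField d β |0|)) := by
    refine (tendsto_finsetSum _ fun i _ => (continuousAt_plusCorr_abs_field_uncurry hd hβ hβc _).tendsto).add ?_
    rw [abs_zero, zero_mul]
    simpa using habs.mul hM
  -- the field part: `|b sign(t) m(b,|t|)| ≤ |b| m(b,|t|) → 0`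
  have hF : Tendsto (fun q : ℝ × ℝ => q.1 * Real.sign q.2 * magnetizationInField d q.1 |q.2|) (𝓝 (β, 0))
      (𝓝 (β * Real.sign 0 * magnetizationInField d β |0|)) := by
    rw [Real.sign_zero, mul_zero, zero_mul]
    have hb : Tendsto (fun q : ℝ × ℝ => |q.1| * magnetizationInField d q.1 |q.2|) (𝓝 (β, 0)) (𝓝 (|β| * 0)) :=
      ((continuous_abs.comp continuous_fst).tendsto _).mul hM
    rw [mul_zero] at hb
    refine squeeze_zero_norm' ?_ hb
    filter_upwards [(isOpen_lt continuous_const continuous_fst).mem_nhds (show (0 : ℝ) < ((β, (0 : ℝ)) : ℝ × ℝ).1 from hβ)]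
      with q hq
    have hm0 : 0 ≤ magnetizationInField d q.1 |q.2| := by
      rw [magnetizationInField_eq_plusCorr]; exact plusCorr_nonneg hq.le (abs_nonneg _) _
    have hs : |Real.sign q.2| ≤ 1 := by
      rcases lt_trichotomy q.2 0 with h | h | h
      · rw [Real.sign_of_neg h]; simp
      · rw [h, Real.sign_zero]; simp
      · rw [Real.sign_of_pos h]; simp
    rw [Real.norm_eq_abs, abs_mul, abs_mul, abs_of_nonneg hm0]
    calc |q.1| * |Real.sign q.2| * magnetizationInField d q.1 |q.2| ≤ |q.1| * 1 * magnetizationInField d q.1 |q.2| := by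
          gcongr
      _ = |q.1| * magnetizationInField d q.1 |q.2| := by ring
  exact (hE.smul tendsto_const_nhds).add (hF.smul tendsto_const_nhds)

/-! ### `C¹` on the open set `{β > 0, h ≠ 0} ∪ {0 < β < β_c, h = 0}` -/

/-- **`ψ` is `C¹` at every point of the open set `U = {β > 0} ∩ ({h ≠ 0} ∪ {β < β_c})`** (`d ≥ 2`): for `β > 0` and
`h ≠ 0 ∨ β < β_c(d)`, `ContDiffAt ℝ 1 (fun (β,h) => ψ(β,h)) (β,h)` (on `U` the surface has the derivative `∇ψ`
everywhere and `∇ψ` is continuous; Mathlib `contDiffAt_one_iff`). [cite: FriedliVelenik2017, Thm. 3.6, Thm. 3.43, Prop. 3.29, Lemma 3.31; Rockafellar1970, Thm. 25.5] -/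
theorem contDiffAt_pressure_uncurry (hd : 2 ≤ d) {β h : ℝ} (hβ : 0 < β) (hq : h ≠ 0 ∨ β < criticalBeta d) :
    ContDiffAt ℝ 1 (fun p : ℝ × ℝ => pressure d p.1 p.2) (β, h) := by
  rw [contDiffAt_one_iff]
  refine ⟨fun q : ℝ × ℝ =>
      (∑ i, plusCorr d q.1 |q.2| {0, Pi.single i 1} + |q.2| * magnetizationInField d q.1 |q.2|) •
          ContinuousLinearMap.fst ℝ ℝ ℝ +
        (q.1 * Real.sign q.2 * magnetizationInField d q.1 |q.2|) • ContinuousLinearMap.snd ℝ ℝ ℝ,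
    {q : ℝ × ℝ | 0 < q.1 ∧ (q.2 ≠ 0 ∨ q.1 < criticalBeta d)}, ?_, ?_, ?_⟩
  · exact ((isOpen_lt continuous_const continuous_fst).inter
      ((isOpen_ne_fun continuous_snd continuous_const).union (isOpen_lt continuous_fst continuous_const))).mem_nhds
      ⟨hβ, hq⟩
  · rintro q ⟨hq1, hq2 | hq2⟩
    · exact (continuousAt_grad_of_field_ne_zero (by omega) hq1 hq2).continuousWithinAt
    · by_cases hq0 : q.2 = 0
      · have : q = (q.1, 0) := by ext <;> simp [hq0]
        rw [this]
        exact (continuousAt_grad_zero_field hd hq1 hq2.le).continuousWithinAt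
      · exact (continuousAt_grad_of_field_ne_zero (by omega) hq1 hq0).continuousWithinAt
  · rintro q ⟨hq1, hq2⟩
    exact hasFDerivAt_pressure_grad hd hq1 (hq2.imp_right le_of_lt)

/-- `C¹` off `h = 0` needs only `d ≥ 1`: for `β > 0`, `h ≠ 0`, `ContDiffAt ℝ 1 ψ̃ (β,h)` (open half-planes, the
quadrant fields of `JointContinuity`). [cite: FriedliVelenik2017, Thm. 3.6, Thm. 3.43 and Lemma 3.31] -/
theorem contDiffAt_pressure_uncurry_of_field_ne_zero (hd : 1 ≤ d) {β h : ℝ} (hβ : 0 < β) (hh : h ≠ 0) :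
    ContDiffAt ℝ 1 (fun p : ℝ × ℝ => pressure d p.1 p.2) (β, h) := by
  -- reduce to `h > 0` by the symmetry `ψ(β,−h) = ψ(β,h)`
  have hposcase : ∀ {b t : ℝ}, 0 < b → 0 < t → ContDiffAt ℝ 1 (fun p : ℝ × ℝ => pressure d p.1 p.2) (b, t) := by
    intro b t hb ht
    rw [contDiffAt_one_iff]
    refine ⟨fun q : ℝ × ℝ =>
        (∑ i, plusCorr d q.1 q.2 {0, Pi.single i 1} + q.2 * magnetizationInField d q.1 q.2) •
            ContinuousLinearMap.fst ℝ ℝ ℝ +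
          (q.1 * magnetizationInField d q.1 q.2) • ContinuousLinearMap.snd ℝ ℝ ℝ,
      {q : ℝ × ℝ | 0 < q.1 ∧ 0 < q.2}, ?_, ?_, ?_⟩
    · exact ((isOpen_lt continuous_const continuous_fst).inter (isOpen_lt continuous_const continuous_snd)).mem_nhds
        ⟨hb, ht⟩
    · intro q hq
      exact (((continuousAt_energyField_uncurry hd hq.1 hq.2).smul continuousAt_const).add
        ((continuousAt_deriv_pressure_field_uncurry hd hq.1 hq.2).smul continuousAt_const)).continuousWithinAt
    · intro q hq
      exact hasFDerivAt_pressure_of_pos_field hd hq.1 hq.2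
  rcases hh.lt_or_gt with hneg | hpos
  · have hflip : ContDiffAt ℝ 1 (fun p : ℝ × ℝ => ((p.1, -p.2) : ℝ × ℝ)) (β, h) := contDiffAt_fst.prodMk contDiffAt_snd.neg
    have hcomp := (hposcase hβ (neg_pos.2 hneg)).comp (β, h) hflip
    refine hcomp.congr_of_eventuallyEq (Eventually.of_forall fun p => ?_)
    simp only [Function.comp_apply, pressure_neg_field]
  · exact hposcase hβ hpos

/-- **`ψ ∈ C¹(U)`, `U = {(β,h) : β > 0, h ≠ 0 ∨ β < β_c(d)}`** (`d ≥ 2`): the pressure surface is continuously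
differentiable on the open complement of the closed coexistence ray `{h = 0, β ≥ β_c}` in the half-plane.
[cite: FriedliVelenik2017, Thm. 3.6, Thm. 3.25, Thm. 3.43; Rockafellar1970, Thm. 25.5] -/
theorem contDiffOn_pressure_uncurry (hd : 2 ≤ d) :
    ContDiffOn ℝ 1 (fun p : ℝ × ℝ => pressure d p.1 p.2) {q | 0 < q.1 ∧ (q.2 ≠ 0 ∨ q.1 < criticalBeta d)} :=
  fun _ hq => (contDiffAt_pressure_uncurry hd hq.1 hq.2).contDiffWithinAt

/-- **Strict Fréchet differentiability on `U`** with the gradient `∇ψ` (`C¹ ⇒` strict). [cite: FriedliVelenik2017, Thm. 3.6 and Thm. 3.43] -/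
theorem hasStrictFDerivAt_pressure_of_mem (hd : 2 ≤ d) {β h : ℝ} (hβ : 0 < β) (hq : h ≠ 0 ∨ β < criticalBeta d) :
    HasStrictFDerivAt (fun p : ℝ × ℝ => pressure d p.1 p.2)
      ((∑ i, plusCorr d β |h| {0, Pi.single i 1} + |h| * magnetizationInField d β |h|) •
          ContinuousLinearMap.fst ℝ ℝ ℝ +
        (β * Real.sign h * magnetizationInField d β |h|) • ContinuousLinearMap.snd ℝ ℝ ℝ) (β, h) :=
  (contDiffAt_pressure_uncurry hd hβ hq).hasStrictFDerivAt' (hasFDerivAt_pressure_grad hd hβ (hq.imp_right le_of_lt))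
    one_ne_zero

/-! ### At the critical point -/

/-- **THE PRESSURE SURFACE IS DIFFERENTIABLE AT THE CRITICAL POINT `(β_c, 0)`** (`d ≥ 2`), with gradient
`(Σᵢ ⟨σ_0σ_{eᵢ}⟩⁺_{β_c,0}, 0)`: no latent heat and no spontaneous magnetisation at `β_c`.
[cite: AizenmanDuminilCopinSidoraviciusCMP2015, Thm. 1.2; FriedliVelenik2017, Prop. 3.29 and Thm. 3.34] -/
theorem hasFDerivAt_pressure_criticalBeta (hd : 2 ≤ d) :
    HasFDerivAt (fun p : ℝ × ℝ => pressure d p.1 p.2)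
      ((∑ i, plusCorr d (criticalBeta d) 0 {0, Pi.single i 1}) • ContinuousLinearMap.fst ℝ ℝ ℝ +
        (0 : ℝ) • ContinuousLinearMap.snd ℝ ℝ ℝ) (criticalBeta d, 0) :=
  hasFDerivAt_pressure_of_le_criticalBeta hd (criticalBeta_pos_holds hd) le_rfl

/-- **THE GRADIENT IS CONTINUOUS AT THE CRITICAL POINT ALONG THE DIFFERENTIABILITY SET** (`d ≥ 2`):
`fderiv ℝ ψ̃ q → fderiv ℝ ψ̃ (β_c, 0)` as `q → (β_c,0)` within `{q | DifferentiableAt ℝ ψ̃ q}` — energy density and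
magnetisation have no jump at `(β_c,0)` from any direction in the `(β,h)`-plane (the field `∇ψ` is continuous at
`(β_c,0)` and equals `fderiv ψ̃` wherever `ψ̃` is differentiable near `(β_c,0)`). [cite: AizenmanDuminilCopinSidoraviciusCMP2015, Thm. 1.2; FriedliVelenik2017, Thm. 3.25, Lemma 3.31, Thm. 3.34] -/
theorem tendsto_fderiv_pressure_criticalBeta (hd : 2 ≤ d) :
    Tendsto (fun q : ℝ × ℝ => fderiv ℝ (fun p : ℝ × ℝ => pressure d p.1 p.2) q)
      (𝓝[{q | DifferentiableAt ℝ (fun p : ℝ × ℝ => pressure d p.1 p.2) q}] (criticalBeta d, 0))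
      (𝓝 (fderiv ℝ (fun p : ℝ × ℝ => pressure d p.1 p.2) (criticalBeta d, 0))) := by
  have hβc := criticalBeta_pos_holds (d := d) hd
  have hgrad := continuousAt_grad_zero_field hd hβc le_rfl
  -- at `(β_c, 0)` the field is the derivative
  have h0 : fderiv ℝ (fun p : ℝ × ℝ => pressure d p.1 p.2) (criticalBeta d, 0) =
      (∑ i, plusCorr d (criticalBeta d) |(0 : ℝ)| {0, Pi.single i 1} +
          |(0 : ℝ)| * magnetizationInField d (criticalBeta d) |0|) • ContinuousLinearMap.fst ℝ ℝ ℝ +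
        (criticalBeta d * Real.sign 0 * magnetizationInField d (criticalBeta d) |0|) • ContinuousLinearMap.snd ℝ ℝ ℝ :=
    (hasFDerivAt_pressure_grad hd hβc (Or.inr le_rfl)).fderiv
  rw [h0]
  refine (hgrad.tendsto.mono_left nhdsWithin_le_nhds).congr' ?_
  -- on the differentiability set near `(β_c,0)` (where `β > 0`), `fderiv = ∇ψ`
  have hev : ∀ᶠ q : ℝ × ℝ in 𝓝[{q | DifferentiableAt ℝ (fun p : ℝ × ℝ => pressure d p.1 p.2) q}] (criticalBeta d, 0),
      0 < q.1 ∧ DifferentiableAt ℝ (fun p : ℝ × ℝ => pressure d p.1 p.2) q := by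
    filter_upwards [mem_nhdsWithin_of_mem_nhds ((isOpen_lt continuous_const continuous_fst).mem_nhds
      (show (0 : ℝ) < ((criticalBeta d, (0 : ℝ)) : ℝ × ℝ).1 from hβc)), self_mem_nhdsWithin] with q hq1 hq2
    exact ⟨hq1, hq2⟩
  filter_upwards [hev] with q hq
  have hq' : q.2 ≠ 0 ∨ q.1 ≤ criticalBeta d := by
    have := (differentiableAt_pressure_uncurry_iff hd hq.1 q.2).1 (by simpa using hq.2)
    by_cases h2 : q.2 = 0
    · exact Or.inr (not_lt.1 fun hlt => this ⟨h2, hlt⟩)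
    · exact Or.inl h2
  have := (hasFDerivAt_pressure_grad hd hq.1 hq').fderiv
  simpa using this.symm

end IsingPressure

end Summit.CriticalPhenomena.PercolationContinuityZ3.Theorems.FK

end
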